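import Summits.CriticalPhenomena.SAWScalingLimit.Theses.SAWTipEnvironment
import Literature.Probability.RandomPlanarGeometry.KestenTwoSidedSAW

/-!
# Birth skeleton (`Lines/birth.lean`) for crux `KestenMeasure` (stmt-CriticalPhenomena-16038)

Route `SAWTipEnvironment` of `CriticalPhenomena/SAWScalingLimit`, crux r3 `KestenMeasure`:
Kesten's two-sided infinite self-avoiding walk exists as the BULK LOCAL LIMIT of the critical
chordal SAW — `∃ μ`, probability measure on `ℤ → ℤ²` carried by rooted bi-infinite SAWs, ergodic
under the re-rooting shift `(T ω) k = ω (k + 1) - ω 1`, whose centred-window probabilities are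
the `δ → 0⁺` limits of the `g(δ·)`-weighted window frequencies of `SAW.law` in every Dobrushin
domain. In tree vocabulary (`Literature/Probability/RandomPlanarGeometry/KestenTwoSidedSAW.lean`)
the crux reads `∃ μ, SAW.KestenTwoSidedSAW μ ∧ SAW.IsBulkLocalLimitOfCriticalSAW μ`
(`SAW.kestenTwoSidedSAW_and_isBulkLocalLimit_iff`, same binders, same order).

## The line — the route header's own two-layer plan, typed
`KestenMeasure ⇐ HalfPlaneToPlane → BulkEquilibrium` (route file, TWO-LAYER PLAN), cut along the
tree's INTRINSIC characterisation of Kesten's measure, the uniform local limit (d')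
`SAW.IsUniformLocalLimit μ` (pattern frequencies of uniform `n`-step SAWs on `ℤ²` re-rooted at a
uniform vertex converge to `μ (cyl r₁ r₂ q)`), so that the three stubs share ONE `μ` without
positing anything:

* `stub_uniformLocalLimitExists : UniformLocalLimitExists` (open problem; Madras–Slade §7.5,
  p. 255, two-sided bulk form; LSW04 §3.4.6 `Q`) — there is a probability measure `μ` on
  `ℤ → ℤ²` that is the uniform local limit: every window-pattern DENSITY of the uniform `n`-step
  planar SAW converges. Whole-plane, canonical ensemble, no domain, no `x_c`. Engine foreseen:
  Kesten's bridge decomposition / half-plane walk (MS93 Thms 8.3.1–8.3.2) + a two-sided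
  unfolding, as for the two-sided LERW (arXiv:1802.06667) and the `d ≥ 5` theorem
  (Markering arXiv:2410.01507 Thms 1.3, 1.6).
* `stub_uniformLimitIsKesten : UniformLimitIsKesten` (L / open) — a probability uniform local
  limit IS a Kesten two-sided SAW: carried by rooted bi-infinite self-avoiding paths, re-rooting
  STATIONARY (bookkeeping: `uniformWindowFreq r₁ (r₂+1) q n = uniformWindowFreq (r₁+1) r₂ q n`
  count the same occurrences, cylinders generate) and — the content — ERGODIC under `T`
  (the `d = 2` analogue of Markering Thm 1.7; mechanism: asymptotic independence of distant
  windows along one walk, pattern-insertion / bridge-renewal mixing).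
* `stub_ensembleEquivalence : EnsembleEquivalence` (open; = the route's `BulkEquilibrium`) —
  EQUIVALENCE OF ENSEMBLES in the bulk: if Kesten's measure `μ` is the uniform local limit, it is
  also the bulk local limit of the critical (`x_c`-grand-canonical) chordal SAW in every
  Dobrushin domain with every endpoint approximation and bump `g` (`SAW.IsBulkLocalLimitOfCriticalSAW μ`):
  bulk windows of the domain walk, `g(δ·)`-weighted (hence at distance `≍ 1` from `∂D`, i.e.
  `≍ δ⁻¹` lattice steps), equilibrate to the whole-plane typical-vertex statistics; the
  boundary, the endpoints and the fugacity conditioning are invisible in the local limit.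
* `KestenMeasure_of (hA : Registered.stub_uniformLocalLimitExists) (hB : Registered.stub_uniformLimitIsKesten)
  (hC : Registered.stub_ensembleEquivalence) : …Theses.SAWTipEnvironment.KestenMeasure`
  (kernel-checked, no `sorry`): `μ` from stub A; `KestenTwoSidedSAW μ` from
  stub B; `IsBulkLocalLimitOfCriticalSAW μ` from stub C; the tree's bridge iff
  `SAW.kestenTwoSidedSAW_and_isBulkLocalLimit_iff` concludes the crux BY NAME.

Hardest stub: `stub_uniformLocalLimitExists` (existence of planar pattern densities, open since
Kesten 1963); `stub_ensembleEquivalence` carries the domain/boundary analysis the crux adds to it.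

## Disproof / negatives used
* `Cruxes/KestenMeasure/Disproof.lean`: none exists (`ledger crux ls stmt-CriticalPhenomena-16038`:
  "no workfiles yet", 2026-08-17) — no `_false_without_` obstruction to honour.
* `ledger negatives --problem CriticalPhenomena` (11 entries, 2026-08-17): none concerns
  infinite-volume SAW measures, local limits or pattern densities (SAW entries: stmt-0772 all-`δ`
  tightness, stmt-5420 hex defect observable, stmt-8261 infinite divisibility, stmt-8312 phase
  retrieval) — no stub asserts tightness, an observable value or a positivity-type claim.
* BC3 probes (this seat, 2026-08-17; files `bc/KestenMeasure_probe_crux.lean`,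
  `bc/KestenMeasure_probe_summit.lean` = the three stub statements below +
  `example : <Stub> → KestenMeasure` / `example : <Stub> → _root_.SAWScalingLimit`, each
  `by first | exact? | simpa [<Stub>] | (unfold <Stub>; simpa) | aesop`, `maxHeartbeats 400000`):
  all SIX probes FAIL — `lean check` rc 1, errors "unsolved goals `a : <Stub> ⊢ KestenMeasure`"
  (lines 29/34/39 of the crux probe file, wall 38.8 s) and "`a : <Stub> ⊢ SAWScalingLimit`"
  (lines 29/34/39 of the summit probe file, wall 17.3 s), each with "aesop: failed to prove the
  goal after exhaustive search" and `exact?` / `simpa` finding nothing — no stub is cheaply the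
  crux or the summit. `lean check --json` of this file: rc 0, errors [], sorries 3 = the three
  `stub_*` (audit: `KestenMeasure_of` proof.conditional exactly on the three `Registered.stub_*`,
  target `…Theses.SAWTipEnvironment.KestenMeasure`; `#h21_check_skeleton` verdict recorded in
  `Lines/birth.md`).
* Vacuity pass: `IsUniformLocalLimit μ` with `IsProbabilityMeasure μ` is not junk-satisfiable —
  for `n ≥ r₁ + r₂` the frequencies `uniformWindowFreq r₁ r₂ · n` sum to `1` over the finitely
  many realisable centred shapes and vanish on the others, matching `Σ_q μ (cyl r₁ r₂ q) = 1`;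
  stubs B and C are conditional on A's object and become vacuous only if A is FALSE (then the
  line is dead at A, visibly).
-/

noncomputable section

open MeasureTheory Filter Topology Set
open Literature.Probability.RandomPlanarGeometry Literature.Probability.LatticeModels

namespace Summit.CriticalPhenomena.SAWScalingLimit.Cruxes.KestenMeasure.Birth

/-! ### 1. The three stub statements -/

/-- **Stub A statement — the uniform local limit exists** (two-sided bulk form of the
convergence of pattern densities, Madras–Slade §7.5 p. 255 / LSW04 §3.4.6 `Q`, OPEN in the
plane): some probability measure `μ` on `ℤ → ℤ²` satisfies `SAW.IsUniformLocalLimit μ`, i.e. for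
every window `[-r₁, r₂]` and pattern `q` the frequency of `q` around a uniform vertex of a uniform
`n`-step SAW on `ℤ²` tends to `μ (SAW.cyl r₁ r₂ q)` as `n → ∞`. -/
def UniformLocalLimitExists : Prop :=
  ∃ μ : Measure (ℤ → Site 2), IsProbabilityMeasure μ ∧ SAW.IsUniformLocalLimit μ

/-- **Stub B statement — a uniform local limit is Kesten's two-sided SAW**: every probability
measure that is the uniform local limit is carried by rooted bi-infinite self-avoiding paths,
stationary under the re-rooting shift (bookkeeping on cylinders) and ERGODIC under it (the
content: `d = 2` analogue of Markering arXiv:2410.01507 Thm 1.7). -/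
def UniformLimitIsKesten : Prop :=
  ∀ μ : Measure (ℤ → Site 2), IsProbabilityMeasure μ → SAW.IsUniformLocalLimit μ →
    SAW.KestenTwoSidedSAW μ

/-- **Stub C statement — equivalence of ensembles in the bulk** (the route's `BulkEquilibrium`):
a Kesten two-sided SAW `μ` that is the uniform (canonical, whole-plane) local limit is also the
bulk local limit of the critical chordal SAW `SAW.law` in every Dobrushin domain, for every
endpoint approximation and bump `g` (`SAW.IsBulkLocalLimitOfCriticalSAW μ`). -/
def EnsembleEquivalence : Prop :=
  ∀ μ : Measure (ℤ → Site 2), SAW.KestenTwoSidedSAW μ → SAW.IsUniformLocalLimit μ →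
    SAW.IsBulkLocalLimitOfCriticalSAW μ

/-! ### 2. Registered stubs -/

/-- Stub A (HARDEST; open problem — planar pattern densities converge, two-sided bulk form).
[Madras–Slade 1993 §7.5; Kesten 1963; LSW04 §3.4.6; Markering arXiv:2410.01507 Thms 1.3/1.6
(`d ≥ 5`); Lawler arXiv:1802.06667 (two-sided LERW)] -/
theorem stub_uniformLocalLimitExists : UniformLocalLimitExists := by
  sorry

/-- Stub B (L / open — support, stationarity: bookkeeping; ergodicity: the content).
[Markering arXiv:2410.01507 Thm 1.7 (`d ≥ 5`); Madras–Slade 1993 §8.3] -/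
theorem stub_uniformLimitIsKesten : UniformLimitIsKesten := by
  sorry

/-- Stub C (open — equivalence of ensembles: `x_c`-grand-canonical chordal walk in `Ω_δ` vs
uniform `n`-step walk on `ℤ²`, bulk windows). [LSW04 §3.4.2–§3.4.6; Madras–Slade 1993 §6.7,
§7.1; DuminilCopinHammond2013 (sub-ballisticity: bulk windows are long stretches)] -/
theorem stub_ensembleEquivalence : EnsembleEquivalence := by
  sorry

/-! ### 3. Name-keyed aliases of the stub statements (hypotheses of the composition)

`Registered.stub_X : Prop` is the statement of `stub_X` under the registered stub's short name, so
that the skeleton audit (`#h21_check_skeleton`: hypotheses admissible iff registered stubs BY NAME)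
accepts `KestenMeasure_of : Registered.stub_… → … → KestenMeasure` (device of
`Cruxes/ChainLaw/Lines/birth.lean`, `Cruxes/DrivingIdentification/Lines/birth.lean`). -/
namespace Registered

/-- Alias keyed by the registered stub name: the statement `UniformLocalLimitExists`. -/
abbrev stub_uniformLocalLimitExists : Prop := UniformLocalLimitExists
/-- Alias keyed by the registered stub name: the statement `UniformLimitIsKesten`. -/
abbrev stub_uniformLimitIsKesten : Prop := UniformLimitIsKesten
/-- Alias keyed by the registered stub name: the statement `EnsembleEquivalence`. -/
abbrev stub_ensembleEquivalence : Prop := EnsembleEquivalence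

end Registered

/-! ### 4. The composition — concludes the crux BY NAME, no `sorry` -/

/-- **`KestenMeasure` from the three stubs.** Take `μ` from stub A; stub B makes it a Kesten
two-sided SAW (probability, SAW-carried, ergodic); stub C makes it the bulk local limit of the
critical chordal SAW; the tree's bridge `SAW.kestenTwoSidedSAW_and_isBulkLocalLimit_iff` unfolds
the pair into the crux's inlined conjunction. -/
theorem KestenMeasure_of (hA : Registered.stub_uniformLocalLimitExists)
    (hB : Registered.stub_uniformLimitIsKesten) (hC : Registered.stub_ensembleEquivalence) :
    Summit.CriticalPhenomena.SAWScalingLimit.Theses.SAWTipEnvironment.KestenMeasure := by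
  obtain ⟨μ, hprob, hU⟩ := hA
  have hKesten : SAW.KestenTwoSidedSAW μ := hB μ hprob hU
  have hBulk : SAW.IsBulkLocalLimitOfCriticalSAW μ := hC μ hKesten hU
  unfold Summit.CriticalPhenomena.SAWScalingLimit.Theses.SAWTipEnvironment.KestenMeasure
  exact ⟨μ, (SAW.kestenTwoSidedSAW_and_isBulkLocalLimit_iff μ).mp ⟨hKesten, hBulk⟩⟩

/-- Wiring check: the registered stubs feed `KestenMeasure_of` as stated. -/
example : Summit.CriticalPhenomena.SAWScalingLimit.Theses.SAWTipEnvironment.KestenMeasure :=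
  KestenMeasure_of stub_uniformLocalLimitExists stub_uniformLimitIsKesten stub_ensembleEquivalence

end Summit.CriticalPhenomena.SAWScalingLimit.Cruxes.KestenMeasure.Birth
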